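import Summits.BirchSwinnertonDyer.Rank1Residual.O5.SignedLevelRaisingTransferThree
import Literature.NumberTheory.EllipticCurves.GoodReductionTorsionReductionProofs
import Literature.NumberTheory.EllipticCurves.GlobalMinimalModel
import HarnessLib

/-!
# Vocabulary for per-level readings of Kurihara numbers in analytic rank one: the local divisibility
# exponent `v_ℓ(P)` of a rational point and the order `ord_p` on `ℤ/p^k` (DEFINITIONS + proved API;
# no conjecture, no named fact, nothing asserted about any curve)

HONEST FRAMING (cell `b2b-bsdres`, run/shared/lean/b2b/bsd-rank1-residual/, verbatim in every
file): the goal of the cell is to DELETE the COMBINATION-SHAPED residual classes of the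
Birch–Swinnerton-Dyer formula for ALL analytic-rank `≤ 1` elliptic curves over `ℚ` — "full BSD
formula for every rank `≤ 1` curve in class `C`" assembled STRICTLY from published theorems — so
that the rank-`≤ 1` remainder becomes exactly the CONSTRUCTION-SHAPED classes, which are TYPED
(missing-input `Prop`s), NOT attempted. This is not "finishing BSD". Seat `b2b-bsdres-additive-p3`
(X8 prover B / X7 joint; instrument of the P-5 rounds; typer-designate for the cell conjecture C-16 by
hyp R-16 (e)). This file is VOCABULARY ONLY: two ℕ-valued definitions and their elementary, fully proved
API. It books nothing and moves no mark; X7 / X8 stay CONSTRUCTION-SHAPED. Its consumer is the typed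
conjecture C-16 = C120.1 (`Ordinary/Conjectures/KuriharaExactOrderRankOneAt3.lean`, the rank-one per-level depth law
`ord₃(δ̃_ℓ mod 3^k) = min(k, v₃ #Ш_an + v₃ ∏ c_q + 2·v_ℓ(P))`), whose two numerical ingredients not yet
in the tree were exactly these (additive-p3 GEN 32 tree survey, INBOX 2026-08-24T00:58:44Z, items (α) and
the reading of `ord₃`); every other clause of that sentence is existing tree vocabulary.

## Contents (all `p`; the conjecture specialises `p = 3`)

* §1 `localDivExponent W p ℓ P : ℕ` — **`v_ℓ(P)`**: the largest `j ≤ e_ℓ := v_p #Ẽ(𝔽_ℓ)`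
  (`W.reductionPointCount ℓ`) such that the image of the rational point `P` in `E(ℚ_ℓ)` is `p^j • Q`
  (`Nat.findGreatest` over the O5 lane's local-divisibility shape `Affine.Point.map (Algebra.ofId ℚ ℚ_[ℓ])
  P = n • Q`, cf. `O5.PointLocallyThreeDivisibleAt`). API: the cap `localDivExponent_le`, attainment and
  monotonicity `exists_eq_pow_smul_of_le_localDivExponent`, maximality `le_localDivExponent` /
  `not_exists_eq_pow_smul_of_localDivExponent_lt`, the bridge `one_le_localDivExponent_three_iff` to the
  O5 DIV bit, and **FAITHFULNESS** `localDivExponent_eq_findGreatest_reduction`: at a good `ℓ ≠ p` it is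
  the largest `j ≤ e_ℓ` with the REDUCTION `P̄ ∈ p^j·Ẽ(𝔽_ℓ)` (Silverman AEC VII.2.1 / IV.2.3 via the tree's
  `exists_nsmul_eq_iff_reduction`) — in a group whose `p`-Sylow is cyclic of order `p^{e_ℓ}` this is the
  `p`-divisibility exponent of `P̄`'s `p`-primary component (`= e_ℓ` iff it is `O`, else
  `e_ℓ − v_p(ord P̄)`): the printed `v_ℓ(P)` of hyp `SHARPENED-CONJECTURES.md` §120 C120.1 and of
  `HOME/b2b-bsdres-additive-p3/R1-DEPTH-LAW.md` §1 ("ONE point multiplication mod `ℓ`").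
* §2 `zmodPowOrd p k x : ℕ` — **`ord_p(x)` for `x ∈ ℤ/p^k`**, valued in `{0, …, k}`: `k` if `x = 0`, else
  `v_p` of the representative `x.val ∈ [1, p^k)`; the P-5 rounds' "exact order `3^m`" / "`9 ∥ δ̃_ℓ`".
  API: `zmodPowOrd_zero`, `_of_ne_zero`, `_lt_of_ne_zero`, `_le`, `_eq_iff_eq_zero` (capped reading),
  `_eq_zero_iff_of_ne_zero` (unit reading); §3 the ideal-theoretic characterisation
  `le_zmodPowOrd_iff_natCast_pow_dvd` (`m ≤ ord_p x ⟺ x ∈ p^m(ℤ/p^k)`, `m ≤ k`), invariance under units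
  `zmodPowOrd_mul_of_isUnit` (so `ord_p` of a Kurihara number does not depend on the choice of surjective
  discrete logarithms, `exists_units_kuriharaNumber_eq_mul`), and level reduction `zmodPowOrd_castHom`
  (`ord_p(x mod p^j) = min(j, ord_p x)`, `j ≤ k` — the reason the depth-`k′` clause of C-16 implies every
  depth-`k ≤ k′` clause, proved in the consumer file).

Nothing here duplicates Mathlib (no ℕ-valued `ord` on `ZMod (p^k)`: `padicValNat` is on `ℕ`, and Mathlib's
`emultiplicity (p : ZMod (p^k)) x ∈ ℕ∞` is `⊤` at `x = 0` — the capped ℕ-valued form is what the sentence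
equates) or the tree
(searched `zmodPowOrd`, `localDiv`, `divisibility exponent`, `findGreatest` + `Point`). Design: plain
`def`s (data, not `Prop`), `noncomputable`, `open scoped Classical` for `Nat.findGreatest`'s decidability.
References: J. H. Silverman, AEC 2nd ed. (2009), VII.2.1, VII.3.1 (b), IV.2.3 [SilvermanAEC2009];
C.-H. Kim, Amer. J. Math. 148 (2026) = arXiv:2203.12159, §1.4.3 (`δ̃_n^{(k)} = δ̃_n mod p^k`)
[Kim2022StructureSelmer]; cell: hyp SC §120, lit `STRUCTURE.md` §2 C-16 / R-16, `R1-DEPTH-LAW.md`.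
-/

noncomputable section

open scoped Classical

open WeierstrassCurve Literature.NumberTheory.EllipticCurves

namespace Summit.BirchSwinnertonDyer.Rank1Residual.Ordinary

/-! ### §1 The local divisibility exponent `v_ℓ(P)` -/

section LocalDivExponent

variable (W : WeierstrassCurve ℚ) [W.IsGloballyMinimal] (p ℓ : ℕ) [Fact ℓ.Prime]

/-- **`v_ℓ(P)`, the local `p`-divisibility exponent of a rational point at the prime `ℓ`, capped at
`e_ℓ = v_p #Ẽ(𝔽_ℓ)`**: the largest `j ≤ padicValNat p (W.reductionPointCount ℓ)` such that the image of
`P` in `E(ℚ_ℓ)` is `p^j • Q` for some `Q ∈ E(ℚ_ℓ)` (`Nat.findGreatest`; `j = 0` always qualifies). At a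
good `ℓ ≠ p` it is the `p`-divisibility exponent of the reduction `P̄` in `Ẽ(𝔽_ℓ)` (AEC VII.2.1 / IV.2.3;
`localDivExponent_eq_findGreatest_reduction`), i.e. for a cyclic `Ẽ(𝔽_ℓ)[p^∞]` of order `p^{e_ℓ}`: `e_ℓ`
iff `P̄`'s `p`-primary component is `O`, else `e_ℓ − v_p(ord P̄)` — the printed `v_ℓ(P)` of hyp §120
C120.1 / `R1-DEPTH-LAW.md` §1. [cite: SilvermanAEC2009, VII.3 Prop. 3.1 (b) and VII.2 Prop. 2.1] -/
def localDivExponent (P : W.toAffine.Point) : ℕ :=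
  Nat.findGreatest
    (fun j => ∃ Q : (W.baseChange ℚ_[ℓ]).toAffine.Point,
      Affine.Point.map (W' := W.toAffine) (Algebra.ofId ℚ ℚ_[ℓ]) P = (p ^ j) • Q)
    (padicValNat p (W.reductionPointCount ℓ))

/-- `v_ℓ(P) ≤ e_ℓ = v_p #Ẽ(𝔽_ℓ)` (the cap: "`= e_ℓ` when `P̄`'s `p`-primary component is `O`"). [folklore] -/
theorem localDivExponent_le (P : W.toAffine.Point) :
    localDivExponent W p ℓ P ≤ padicValNat p (W.reductionPointCount ℓ) :=
  Nat.findGreatest_le _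

/-- `P` is `p^j`-divisible in `E(ℚ_ℓ)` for every `j ≤ v_ℓ(P)` (`j = 0` qualifies, so `Nat.findGreatest`
attains, and `p^v • Q = p^j • (p^{v−j} • Q)`). [folklore] -/
theorem exists_eq_pow_smul_of_le_localDivExponent (P : W.toAffine.Point) {j : ℕ}
    (hj : j ≤ localDivExponent W p ℓ P) :
    ∃ Q : (W.baseChange ℚ_[ℓ]).toAffine.Point,
      Affine.Point.map (W' := W.toAffine) (Algebra.ofId ℚ ℚ_[ℓ]) P = (p ^ j) • Q := by
  obtain ⟨Q, hQ⟩ : ∃ Q : (W.baseChange ℚ_[ℓ]).toAffine.Point,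
      Affine.Point.map (W' := W.toAffine) (Algebra.ofId ℚ ℚ_[ℓ]) P =
        (p ^ localDivExponent W p ℓ P) • Q := by
    unfold localDivExponent
    exact Nat.findGreatest_spec (P := fun j => ∃ Q : (W.baseChange ℚ_[ℓ]).toAffine.Point,
        Affine.Point.map (W' := W.toAffine) (Algebra.ofId ℚ ℚ_[ℓ]) P = (p ^ j) • Q) (Nat.zero_le _)
      ⟨Affine.Point.map (W' := W.toAffine) (Algebra.ofId ℚ ℚ_[ℓ]) P, by rw [pow_zero, one_smul]⟩
  refine ⟨(p ^ (localDivExponent W p ℓ P - j)) • Q, ?_⟩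
  rw [hQ, ← mul_smul, ← pow_add, Nat.add_sub_cancel' hj]

/-- A divisibility `P = p^j • Q` in `E(ℚ_ℓ)` with `j ≤ e_ℓ` bounds `v_ℓ(P)` from below. [folklore] -/
theorem le_localDivExponent (P : W.toAffine.Point) {j : ℕ}
    (hj : j ≤ padicValNat p (W.reductionPointCount ℓ))
    (h : ∃ Q : (W.baseChange ℚ_[ℓ]).toAffine.Point,
      Affine.Point.map (W' := W.toAffine) (Algebra.ofId ℚ ℚ_[ℓ]) P = (p ^ j) • Q) :
    j ≤ localDivExponent W p ℓ P := by
  unfold localDivExponent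
  exact Nat.le_findGreatest (P := fun j => ∃ Q : (W.baseChange ℚ_[ℓ]).toAffine.Point,
      Affine.Point.map (W' := W.toAffine) (Algebra.ofId ℚ ℚ_[ℓ]) P = (p ^ j) • Q) hj h

/-- `P` is NOT `p^j`-divisible in `E(ℚ_ℓ)` for `v_ℓ(P) < j ≤ e_ℓ` (exact below the cap). [folklore] -/
theorem not_exists_eq_pow_smul_of_localDivExponent_lt (P : W.toAffine.Point) {j : ℕ}
    (hlt : localDivExponent W p ℓ P < j) (hj : j ≤ padicValNat p (W.reductionPointCount ℓ)) :
    ¬ ∃ Q : (W.baseChange ℚ_[ℓ]).toAffine.Point,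
      Affine.Point.map (W' := W.toAffine) (Algebra.ofId ℚ ℚ_[ℓ]) P = (p ^ j) • Q := by
  unfold localDivExponent at hlt
  exact Nat.findGreatest_is_greatest hlt hj

/-- **At `p = 3`, `v_ℓ(P) ≥ 1` is the O5 lane's DIV bit `PointLocallyThreeDivisibleAt W ℓ P`**,
provided `3 ∣ #Ẽ(𝔽_ℓ)` (true at every Kolyvagin prime of level `≥ 1`). [folklore] -/
theorem one_le_localDivExponent_three_iff (P : W.toAffine.Point)
    (he : 1 ≤ padicValNat 3 (W.reductionPointCount ℓ)) :
    1 ≤ localDivExponent W 3 ℓ P ↔ O5.PointLocallyThreeDivisibleAt W ℓ P := by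
  constructor
  · intro h
    obtain ⟨Q, hQ⟩ := exists_eq_pow_smul_of_le_localDivExponent W 3 ℓ P h
    exact ⟨Q, by rw [hQ, pow_one]⟩
  · rintro ⟨Q, hQ⟩
    exact le_localDivExponent W 3 ℓ P he ⟨Q, by rw [hQ, pow_one]⟩

/-- **FAITHFULNESS to the printed reduction form.** At a prime `ℓ ∤ Δ_W` (good reduction) with
`ℓ ≠ p`, `v_ℓ(P)` is the largest `j ≤ e_ℓ` such that the REDUCTION `P̄ ∈ Ẽ(𝔽_ℓ)` of `P` (the tree's
`reducePoint` of the `ℤ_ℓ`-model `integralModelInt W ⊗ ℤ_ℓ`, read on `(W ⊗ ℚ_ℓ)`-points along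
`padicModel_baseChange`, exactly as in `GoodReductionTorsionReductionProofs` / the O5 lane) lies in
`p^j · Ẽ(𝔽_ℓ)` — Silverman AEC VII.2.1 / IV.2.3 (`P ∈ nE(ℚ_ℓ) ⟺ P̄ ∈ nẼ(𝔽_ℓ)`, `ℓ ∤ n`; tree
`exists_nsmul_eq_iff_reduction`). [cite: SilvermanAEC2009, Prop. VII.2.1 and Prop. IV.2.3] -/
theorem localDivExponent_eq_findGreatest_reduction [W.IsElliptic]
    (hgood : ¬ (ℓ : ℤ) ∣ minimalDiscriminantInt W) (hp : p.Prime) (hℓp : ℓ ≠ p)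
    (P : W.toAffine.Point) :
    localDivExponent W p ℓ P = Nat.findGreatest
      (fun j => ∃ c : (((integralModelInt W).map (Int.castRingHom ℤ_[ℓ])).map
          (IsLocalRing.residue ℤ_[ℓ])).toAffine.Point,
        (p ^ j) • c = reducePoint ((integralModelInt W).map (Int.castRingHom ℤ_[ℓ]))
          (Affine.Point.congrEquiv (W.padicModel_baseChange ℓ).symm
            (Affine.Point.map (W' := W.toAffine) (Algebra.ofId ℚ ℚ_[ℓ]) P)))
      (padicValNat p (W.reductionPointCount ℓ)) := by
  have hℓ : ℓ.Prime := Fact.out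
  have hn : ∀ j : ℕ, ¬ ℓ ∣ p ^ j := fun j h =>
    hℓp ((Nat.prime_dvd_prime_iff_eq hℓ hp).mp (hℓ.dvd_of_dvd_pow h))
  have key : ∀ j : ℕ, (∃ Q : (W.baseChange ℚ_[ℓ]).toAffine.Point,
      Affine.Point.map (W' := W.toAffine) (Algebra.ofId ℚ ℚ_[ℓ]) P = (p ^ j) • Q) ↔
      ∃ c : (((integralModelInt W).map (Int.castRingHom ℤ_[ℓ])).map
          (IsLocalRing.residue ℤ_[ℓ])).toAffine.Point,
        (p ^ j) • c = reducePoint ((integralModelInt W).map (Int.castRingHom ℤ_[ℓ]))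
          (Affine.Point.congrEquiv (W.padicModel_baseChange ℓ).symm
            (Affine.Point.map (W' := W.toAffine) (Algebra.ofId ℚ ℚ_[ℓ]) P)) := fun j => by
    rw [← exists_nsmul_eq_iff_reduction hgood (hn j)]
    exact ⟨fun ⟨Q, h⟩ => ⟨Q, h.symm⟩, fun ⟨Q, h⟩ => ⟨Q, h.symm⟩⟩
  unfold localDivExponent
  exact le_antisymm (Nat.findGreatest_mono_left (fun j h => (key j).mp h) _)
    (Nat.findGreatest_mono_left (fun j h => (key j).mpr h) _)

end LocalDivExponent

/-! ### §2 The order `ord_p` on `ℤ/p^k` -/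

section ZModPowOrd

/-- **`ord_p(x)` for `x ∈ ℤ/p^k`**, valued in `{0, …, k}`: `k` if `x = 0`, otherwise the `p`-adic valuation of
the representative `x.val ∈ [1, p^k)` (so `< k`). For a prime `p` this is the largest `m ≤ k` with
`x ∈ p^m(ℤ/p^k)`; "`ord₃(δ̃_ℓ mod 3^k) = 2`" is the rounds' "`9 ∥ δ̃_ℓ`". [folklore] -/
def zmodPowOrd (p k : ℕ) (x : ZMod (p ^ k)) : ℕ :=
  if x = 0 then k else padicValNat p x.val

/-- `ord_p(0 mod p^k) = k`. [folklore] -/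
@[simp] theorem zmodPowOrd_zero (p k : ℕ) : zmodPowOrd p k 0 = k := by
  simp [zmodPowOrd]

/-- For `x ≠ 0`, `ord_p(x) = v_p(x.val)`. [folklore] -/
theorem zmodPowOrd_of_ne_zero {p k : ℕ} {x : ZMod (p ^ k)} (hx : x ≠ 0) :
    zmodPowOrd p k x = padicValNat p x.val := by
  simp [zmodPowOrd, hx]

/-- For `x ≠ 0` and `p > 1`, `ord_p(x) < k` (`0 < x.val < p^k`, `p^{ord} ∣ x.val`). [folklore] -/
theorem zmodPowOrd_lt_of_ne_zero {p k : ℕ} (hp : 1 < p) {x : ZMod (p ^ k)} (hx : x ≠ 0) :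
    zmodPowOrd p k x < k := by
  haveI : NeZero (p ^ k) := ⟨pow_ne_zero k (by omega)⟩
  rw [zmodPowOrd_of_ne_zero hx]
  have hval : 0 < x.val := Nat.pos_of_ne_zero fun h => hx ((ZMod.val_eq_zero x).mp h)
  have hlt : x.val < p ^ k := ZMod.val_lt x
  have hdvd : p ^ padicValNat p x.val ∣ x.val := pow_padicValNat_dvd
  have hle : p ^ padicValNat p x.val ≤ x.val := Nat.le_of_dvd hval hdvd
  exact (Nat.pow_lt_pow_iff_right hp).mp (lt_of_le_of_lt hle hlt)

/-- `ord_p(x) = k` iff `x = 0` (`p > 1`): the CAPPED reading "`δ̃_ℓ ≡ 0 (mod p^k)`". [folklore] -/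
theorem zmodPowOrd_eq_iff_eq_zero {p k : ℕ} (hp : 1 < p) (x : ZMod (p ^ k)) :
    zmodPowOrd p k x = k ↔ x = 0 := by
  refine ⟨fun h => ?_, fun h => by rw [h, zmodPowOrd_zero]⟩
  by_contra hx
  exact (zmodPowOrd_lt_of_ne_zero hp hx).ne h

/-- `ord_p(x) = 0` for `x ≠ 0` iff `p ∤ x.val`, i.e. `x` is a unit of `ℤ/p^k` when `p` is prime and
`k ≥ 1`: the UNIT reading. [folklore] -/
theorem zmodPowOrd_eq_zero_iff_of_ne_zero {p k : ℕ} (hp : 1 < p) {x : ZMod (p ^ k)} (hx : x ≠ 0) :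
    zmodPowOrd p k x = 0 ↔ ¬ p ∣ x.val := by
  haveI : NeZero (p ^ k) := ⟨pow_ne_zero k (by omega)⟩
  have hval : x.val ≠ 0 := fun h => hx ((ZMod.val_eq_zero x).mp h)
  rw [zmodPowOrd_of_ne_zero hx, padicValNat.eq_zero_iff]
  constructor
  · rintro (h | h | h)
    · omega
    · exact absurd h hval
    · exact h
  · exact fun h => Or.inr (Or.inr h)

end ZModPowOrd

/-! ### §3 `ord_p`: ideal-theoretic characterisation, units, level reduction -/

section ZModPowOrdLevels

variable {p : ℕ}

/-- In `ℤ/p^n`, divisibility by `p^m` (`m ≤ n`) is divisibility of the representative `val ∈ [0, p^n)`.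
[folklore] -/
theorem natCast_pow_dvd_iff_dvd_val (hp : p.Prime) {n m : ℕ} (hm : m ≤ n) (y : ZMod (p ^ n)) :
    ((p ^ m : ℕ) : ZMod (p ^ n)) ∣ y ↔ p ^ m ∣ y.val := by
  haveI : NeZero (p ^ n) := ⟨pow_ne_zero n hp.ne_zero⟩
  constructor
  · rintro ⟨c, hc⟩
    have hval : y.val = (p ^ m % p ^ n) * c.val % p ^ n := by
      rw [hc, ZMod.val_mul, ZMod.val_natCast]
    rw [hval]
    exact (Nat.dvd_mod_iff (pow_dvd_pow p hm)).mpr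
      (Dvd.dvd.mul_right ((Nat.dvd_mod_iff (pow_dvd_pow p hm)).mpr dvd_rfl) _)
  · rintro ⟨t, ht⟩
    refine ⟨(t : ZMod (p ^ n)), ?_⟩
    rw [← ZMod.natCast_zmod_val y, ht, Nat.cast_mul]

/-- `m ≤ ord_p(y)` iff `p^m ∣ y.val`, for `m ≤ n` (`y = 0`: both sides hold). [folklore] -/
theorem le_zmodPowOrd_iff_dvd_val (hp : p.Prime) {n m : ℕ} (hm : m ≤ n) (y : ZMod (p ^ n)) :
    m ≤ zmodPowOrd p n y ↔ p ^ m ∣ y.val := by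
  haveI : NeZero (p ^ n) := ⟨pow_ne_zero n hp.ne_zero⟩
  haveI : Fact p.Prime := ⟨hp⟩
  by_cases hy : y = 0
  · subst hy
    simp [zmodPowOrd_zero, hm]
  · have hval : y.val ≠ 0 := fun h => hy ((ZMod.val_eq_zero y).mp h)
    rw [zmodPowOrd_of_ne_zero hy, padicValNat_dvd_iff_le hval]

/-- `m ≤ ord_p(y)` iff `p^m ∣ y` in `ℤ/p^n`, for `m ≤ n`: `ord_p` is the largest `m ≤ n` with
`y ∈ p^m(ℤ/p^n)`. [folklore] -/
theorem le_zmodPowOrd_iff_natCast_pow_dvd (hp : p.Prime) {n m : ℕ} (hm : m ≤ n) (y : ZMod (p ^ n)) :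
    m ≤ zmodPowOrd p n y ↔ ((p ^ m : ℕ) : ZMod (p ^ n)) ∣ y := by
  rw [le_zmodPowOrd_iff_dvd_val hp hm, natCast_pow_dvd_iff_dvd_val hp hm]

/-- `ord_p(y) ≤ n`. [folklore] -/
theorem zmodPowOrd_le (hp : p.Prime) {n : ℕ} (y : ZMod (p ^ n)) : zmodPowOrd p n y ≤ n := by
  by_cases hy : y = 0
  · rw [hy, zmodPowOrd_zero]
  · exact (zmodPowOrd_lt_of_ne_zero hp.one_lt hy).le

/-- Two elements of `ℤ/p^n` divisible by the same powers `p^m`, `m ≤ n`, have the same `ord_p`.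
[folklore] -/
theorem zmodPowOrd_eq_of_forall_dvd_iff (hp : p.Prime) {n : ℕ} {x y : ZMod (p ^ n)}
    (h : ∀ m ≤ n, (((p ^ m : ℕ) : ZMod (p ^ n)) ∣ x ↔ ((p ^ m : ℕ) : ZMod (p ^ n)) ∣ y)) :
    zmodPowOrd p n x = zmodPowOrd p n y := by
  apply le_antisymm
  · have hm := zmodPowOrd_le hp x
    exact (le_zmodPowOrd_iff_natCast_pow_dvd hp hm y).mpr
      ((h _ hm).mp ((le_zmodPowOrd_iff_natCast_pow_dvd hp hm x).mp le_rfl))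
  · have hm := zmodPowOrd_le hp y
    exact (le_zmodPowOrd_iff_natCast_pow_dvd hp hm x).mpr
      ((h _ hm).mpr ((le_zmodPowOrd_iff_natCast_pow_dvd hp hm y).mp le_rfl))

/-- **`ord_p` is blind to units**: `ord_p(u·y) = ord_p(y)` for a unit `u` of `ℤ/p^n` — so the choice of
(surjective) discrete logarithms does not affect `ord_p` of a Kurihara number. [folklore] -/
theorem zmodPowOrd_mul_of_isUnit (hp : p.Prime) {n : ℕ} {u : ZMod (p ^ n)} (hu : IsUnit u)
    (y : ZMod (p ^ n)) : zmodPowOrd p n (u * y) = zmodPowOrd p n y :=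
  zmodPowOrd_eq_of_forall_dvd_iff hp fun _ _ => hu.dvd_mul_left

/-- **`ord_p` under level reduction**: reducing `y ∈ ℤ/p^k` to `ℤ/p^j` (`j ≤ k`) caps `ord_p` at `j`:
`ord_p(y mod p^j) = min(j, ord_p(y))`. [folklore] -/
theorem zmodPowOrd_castHom (hp : p.Prime) {j k : ℕ} (hjk : j ≤ k) (y : ZMod (p ^ k)) :
    zmodPowOrd p j (ZMod.castHom (pow_dvd_pow p hjk) (ZMod (p ^ j)) y) =
      min j (zmodPowOrd p k y) := by
  haveI : NeZero (p ^ k) := ⟨pow_ne_zero k hp.ne_zero⟩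
  haveI : NeZero (p ^ j) := ⟨pow_ne_zero j hp.ne_zero⟩
  set z := ZMod.castHom (pow_dvd_pow p hjk) (ZMod (p ^ j)) y with hz
  have hzval : z.val = y.val % p ^ j := by
    rw [hz, ZMod.castHom_apply, ZMod.cast_eq_val, ZMod.val_natCast]
  -- for `m ≤ j`: `p^m ∣ z.val ↔ p^m ∣ y.val`
  have key : ∀ m ≤ j, (m ≤ zmodPowOrd p j z ↔ m ≤ zmodPowOrd p k y) := fun m hm => by
    rw [le_zmodPowOrd_iff_dvd_val hp hm, le_zmodPowOrd_iff_dvd_val hp (hm.trans hjk), hzval,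
      Nat.dvd_mod_iff (pow_dvd_pow p hm)]
  apply le_antisymm
  · have hzj := zmodPowOrd_le hp z
    exact le_min hzj ((key _ hzj).mp le_rfl)
  · rcases le_total j (zmodPowOrd p k y) with hle | hle
    · rw [min_eq_left hle]
      exact (key j le_rfl).mpr hle
    · rw [min_eq_right hle]
      exact (key _ hle).mpr le_rfl

end ZModPowOrdLevels

end Summit.BirchSwinnertonDyer.Rank1Residual.Ordinary

end
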